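import Literature.Probability.RandomPlanarGeometry.SLETraceKappaLimit
import Literature.Probability.RandomPlanarGeometry.CritPercSLESimplePathHolds
import Literature.Probability.RandomPlanarGeometry.DrivingFunctionMeasurable
import Literature.Probability.RandomPlanarGeometry.LocalMartingaleProofs
import Literature.Probability.RandomPlanarGeometry.SLERestrictionMartingale
import Mathlib.MeasureTheory.Constructions.BorelSpace.Metric
import HarnessLib

/-!
# `stub_sleBd` — the SLE(8/3) reference curve keeps a positive distance from the boundary on a
compact time window (crux `PathUpgradeR`, stmt-CriticalPhenomena-18055, route `SAWReversalUpgrade`,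
line `bidir_windows`)

Landing target:
`Summits/CriticalPhenomena/SAWScalingLimit/Theorems/SAWReversalUpgradePathUpgradeRSLEBd.lean`
(`--supports stmt-CriticalPhenomena-18055`; registered stub `stub_sleBd`).

The registered theorem `stub_sleBd` is a quantile lemma for the SLE(8/3) reference sample
`γ = sleTrace (8/3) ω` seen in a Dobrushin domain `E` through the boundary extension `ψ̄` of a
chordal uniformizer `ψ : ℍ ≃ E`: for every time horizon `T`, every `α > 0` and every budget `β > 0`
there is a deterministic `dB > 0` such that the event "`ψ̄ (γ u)` is at distance `< dB` from
`∂E` for some `u ∈ [α, T + 1]`" has `P'`-measure at most `β`.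

Proof (sub-namespace `PathUpgradeRSLERegBd`, general `0 < κ ≤ 4`): almost surely the trace is
simple (`ae_isSimpleTrace_sleTrace_of_le_four_apply`), so `γ u ∈ ℍ` for `u > 0` and
`ψ̄ (γ u) = ψ (γ u) ∈ E`, an open set, whence `infDist (ψ̄ (γ u)) ∂E > 0`; by continuity and
compactness this distance is bounded below on `[α/2, T + 2]`. The measurable supersets
`B n := {∃ q ∈ S, α/2 < q < T + 2, infDist (ψ̄ (γ q)) ∂E < 1/(n+1)}` (`S` a countable dense set of
times; marginal measurability `measurable_sleTrace` and continuity of `ψ̄ ∘ liftIm 0`) decrease to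
a null set; continuity from above (`tendsto_measure_iInter_atTop`) gives `P' (B n) → 0`, and the
event of the statement with `dB := 1/(n+1)` is contained in `B n` by continuity in time and
density of `S`. This imitates `PathUpgradeRRangeBound.exists_measure_tail_le`.
-/

noncomputable section

open scoped ENNReal NNReal Topology
open MeasureTheory Filter Set Metric TopologicalSpace
open Literature.Probability Literature.Probability.RandomPlanarGeometry
open UpperHalfPlane (upperHalfPlaneSet)

namespace Summit.CriticalPhenomena.SAWScalingLimit.Theorems

namespace PathUpgradeRSLERegBd

/-- A point of a Dobrushin domain is at positive distance from its boundary: the carrier is open,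
so it misses the (closed, nonempty) frontier. [folklore] -/
theorem infDist_frontier_pos {D : DobrushinDomain} {x : ℂ} (hx : x ∈ D.carrier) :
    0 < infDist x (frontier D.carrier) := by
  refine (isClosed_frontier.notMem_iff_infDist_pos ⟨_, D.boundary_mem_frontier 0⟩).1 ?_
  intro h
  have h2 := h.2
  rw [D.isOpen.interior_eq] at h2
  exact h2 hx

/-- The SLE boundary distance: for `0 < κ ≤ 4`, a conformal equivalence `φ : ℍ ≃ D`, a horizon
`T`, `α > 0` and `β > 0`, some `dB > 0` has
`P' {∃ u ∈ [α, T + 1], infDist (φ̄ (γ u)) ∂D < dB} ≤ β`. Almost surely the trace is simple, so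
`φ̄ (γ u) ∈ D` for `u > 0` and the continuous function `u ↦ infDist (φ̄ (γ u)) ∂D` is bounded
below on the compact window `[α/2, T + 2]`; the measurable supersets
`{∃ q ∈ S, α/2 < q < T + 2, infDist (φ̄ (γ q)) ∂D < 1/(n+1)}` (`S` countable dense) decrease to a
null set. [folklore] -/
theorem exists_measure_infDist_lt_le {κ : ℝ≥0} (h0 : 0 < κ) (h4 : κ ≤ 4) {D : DobrushinDomain}
    (φ : ConformalEquiv upperHalfPlaneSet D.carrier) (T : ℝ≥0) {α : ℝ} (hα : 0 < α)
    {β : ℝ≥0∞} (hβ : 0 < β) :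
    ∃ dB : ℝ, 0 < dB ∧ Process.preWienerMeasure {ω | ∃ u : ℝ≥0, α ≤ (u : ℝ) ∧ (u : ℝ) ≤ T + 1 ∧
      infDist (φ.boundaryExtension (sleTrace κ ω u)) (frontier D.carrier) < dB} ≤ β := by
  haveI : IsProbabilityMeasure Process.preWienerMeasure := isProbabilityMeasure_preWienerMeasure'
  have hΦc : Continuous fun z ↦ φ.boundaryExtension (Loewner.liftIm 0 z) :=
    continuous_boundaryExtension_liftIm φ
  have hfeq : ∀ (ω : ℝ≥0 → ℝ) (t : ℝ≥0),
      infDist (φ.boundaryExtension (Loewner.liftIm 0 (sleTrace κ ω t))) (frontier D.carrier) =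
        infDist (φ.boundaryExtension (sleTrace κ ω t)) (frontier D.carrier) := fun ω t ↦ by
    rw [Loewner.liftIm_of_le (sleTrace_im_nonneg κ ω t)]
  have hfm : ∀ t : ℝ≥0, Measurable fun ω : ℝ≥0 → ℝ ↦
      infDist (φ.boundaryExtension (Loewner.liftIm 0 (sleTrace κ ω t))) (frontier D.carrier) :=
    fun t ↦ (hΦc.measurable.comp (measurable_sleTrace κ t)).infDist
  have hfc : ∀ ω : ℝ≥0 → ℝ, Continuous fun t : ℝ≥0 ↦
      infDist (φ.boundaryExtension (Loewner.liftIm 0 (sleTrace κ ω t))) (frontier D.carrier) :=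
    fun ω ↦ (continuous_infDist_pt _).comp (hΦc.comp (continuous_sleTrace κ ω))
  obtain ⟨S, hSc, hSd⟩ := TopologicalSpace.exists_countable_dense ℝ≥0
  obtain ⟨B, hBmem⟩ : ∃ B : ℕ → Set (ℝ≥0 → ℝ), ∀ n ω, ω ∈ B n ↔ ∃ q ∈ S, α / 2 < (q : ℝ) ∧
      (q : ℝ) < T + 2 ∧
      infDist (φ.boundaryExtension (Loewner.liftIm 0 (sleTrace κ ω q))) (frontier D.carrier) <
        1 / ((n : ℝ) + 1) :=
    ⟨fun n ↦ {ω | ∃ q ∈ S, α / 2 < (q : ℝ) ∧ (q : ℝ) < T + 2 ∧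
      infDist (φ.boundaryExtension (Loewner.liftIm 0 (sleTrace κ ω q))) (frontier D.carrier) <
        1 / ((n : ℝ) + 1)}, fun _ _ ↦ Iff.rfl⟩
  have hBm : ∀ n, MeasurableSet (B n) := by
    intro n
    have hrep : B n = ⋃ q ∈ {q ∈ S | α / 2 < (q : ℝ) ∧ (q : ℝ) < T + 2},
        {ω | infDist (φ.boundaryExtension (Loewner.liftIm 0 (sleTrace κ ω q)))
          (frontier D.carrier) < 1 / ((n : ℝ) + 1)} := by
      ext ω
      simp only [hBmem, mem_iUnion, mem_setOf_eq, exists_prop, and_assoc]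
    rw [hrep]
    exact MeasurableSet.biUnion (hSc.mono (sep_subset _ _))
      fun q _ ↦ measurableSet_lt (hfm q) measurable_const
  have hanti : Antitone B := fun n n' hnn' ω hω ↦ by
    obtain ⟨q, hqS, hq1, hq2, hωq⟩ := (hBmem n' ω).1 hω
    exact (hBmem n ω).2 ⟨q, hqS, hq1, hq2, hωq.trans_le (Nat.one_div_le_one_div hnn')⟩
  have hnull : Process.preWienerMeasure (⋂ n, B n) = 0 := by
    rw [measure_eq_zero_iff_ae_notMem]
    filter_upwards [ae_isSimpleTrace_sleTrace_of_le_four_apply h0 h4] with ω hω hmem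
    have hpos : ∀ s ∈ Icc (α / 2).toNNReal (T + 2),
        0 < infDist (φ.boundaryExtension (Loewner.liftIm 0 (sleTrace κ ω s)))
          (frontier D.carrier) := by
      intro s hs
      rw [hfeq]
      have hs0 : 0 < s := (Real.toNNReal_pos.2 (half_pos hα)).trans_le hs.1
      have him : 0 < (sleTrace κ ω s).im := hω.2 s hs0
      rw [φ.boundaryExtension_eq (show sleTrace κ ω s ∈ upperHalfPlaneSet from him)]
      exact infDist_frontier_pos (φ.mapsTo him)
    obtain ⟨δ, hδ0, hδ⟩ := isCompact_Icc.exists_forall_le' (hfc ω).continuousOn hpos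
    obtain ⟨n, hn⟩ := exists_nat_one_div_lt hδ0
    obtain ⟨q, -, hq1, hq2, hωq⟩ := (hBmem n ω).1 (mem_iInter.1 hmem n)
    have hqK : q ∈ Icc (α / 2).toNNReal (T + 2) :=
      ⟨Real.toNNReal_le_iff_le_coe.2 hq1.le, by exact_mod_cast hq2.le⟩
    exact absurd (hδ q hqK) (not_le.2 (hωq.trans hn))
  have htend := tendsto_measure_iInter_atTop (μ := Process.preWienerMeasure)
    (fun n ↦ (hBm n).nullMeasurableSet) hanti ⟨0, measure_ne_top _ _⟩
  rw [hnull] at htend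
  obtain ⟨n, hn⟩ := (htend.eventually_lt_const hβ).exists
  refine ⟨1 / ((n : ℝ) + 1), Nat.one_div_pos_of_nat, (measure_mono ?_).trans hn.le⟩
  rintro ω ⟨u, hαu, huT, hωu⟩
  have hopen : IsOpen {s : ℝ≥0 | α / 2 < (s : ℝ) ∧ (s : ℝ) < T + 2 ∧
      infDist (φ.boundaryExtension (Loewner.liftIm 0 (sleTrace κ ω s))) (frontier D.carrier) <
        1 / ((n : ℝ) + 1)} :=
    (isOpen_lt continuous_const NNReal.continuous_coe).inter
      ((isOpen_lt NNReal.continuous_coe continuous_const).inter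
        (isOpen_lt (hfc ω) continuous_const))
  obtain ⟨q, hqS, hq⟩ := hSd.exists_mem_open hopen
    ⟨u, by linarith, by linarith, by rwa [hfeq]⟩
  exact (hBmem n ω).2 ⟨q, hqS, hq⟩

end PathUpgradeRSLERegBd

/-- **SLE boundary distance quantile** (registered stub `stub_sleBd` of line `bidir_windows`): for
the SLE(8/3) reference sample seen in the Dobrushin domain `E` through the boundary extension of a
chordal uniformizer `ψ`, every horizon `T`, every `α > 0` and every budget `β > 0` admit a
deterministic `dB > 0` with `P' {∃ u ∈ [α, T + 1], infDist (ψ̄ (γ u)) ∂E < dB} ≤ β` (a.s. simple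
trace for `κ = 8/3 ≤ 4`, openness of `E`, compactness of the window, continuity from above).
[folklore] -/
theorem stub_sleBd : ∀ (E : Literature.Probability.RandomPlanarGeometry.DobrushinDomain) (ψ : Literature.Probability.RandomPlanarGeometry.ConformalEquiv UpperHalfPlane.upperHalfPlaneSet E.carrier), E.IsChordalUniformizing ψ → ∀ (T : NNReal) (α : ℝ), 0 < α → ∀ β : ENNReal, 0 < β → ∃ dB : ℝ, 0 < dB ∧ Literature.Probability.Process.preWienerMeasure {ω | ∃ u : NNReal, α ≤ (u : ℝ) ∧ (u : ℝ) ≤ T + 1 ∧ Metric.infDist (ψ.boundaryExtension (Literature.Probability.RandomPlanarGeometry.sleTrace ((8:NNReal)/3) ω u)) (frontier E.carrier) < dB} ≤ β := by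
  intro E ψ _ T α hα β hβ
  have hκ0 : (0 : ℝ≥0) < 8 / 3 := by positivity
  have hκ4 : (8 : ℝ≥0) / 3 ≤ 4 := by
    rw [div_le_iff₀ (by norm_num : (0 : ℝ≥0) < 3)]
    norm_num
  exact PathUpgradeRSLERegBd.exists_measure_infDist_lt_le hκ0 hκ4 ψ T hα hβ

end Summit.CriticalPhenomena.SAWScalingLimit.Theorems

end
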